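import Summits.Schanuel.Schanuel.Theorems.ZilberEacAnalyticPuiseux
import HarnessLib

/-!
# Arbitrary base branches, XCI: THE ANALYTIC NEWTON–PUISEUX THEOREM, root form — a polynomial with
# analytic rows (any nonzero top row, nonzero constant row) has a root `ψ(σ)σ^L`, `ψ(0) ≠ 0`,
# `s = σ^e` (a nonzero convergent Puiseux series)

HONEST FRAMING.  Cell `pub-schanuel` (Zilber's Exponential-Algebraic Closedness, case ladder;
host summit Schanuel), seat 2, gen 33.  **`exists_puiseuxRoot_analyticRows`**: let
`R(s, y) = Σ_{j ≤ d} Q_j(s) y^j` (`d ≥ 1`) have rows `Q_j` analytic at `0` with `Q_d ≢ 0` and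
`Q_0 ≢ 0`, and a Bézout element with analytic rows `A R + B ∂_yR = r(s)` (`r ≢ 0`) on a punctured
neighbourhood of `0`.  Then there are `e ≥ 1`, `L ∈ ℤ` and `ψ` analytic at `0` with `ψ(0) ≠ 0`
such that `R(σ^e, ψ(σ)σ^L) = 0` for all small `σ ≠ 0` — exactly the fibre datum consumed by the
germ theorems of files LXVII / LXXXIII / LXXXIX.  Reduction to the monic core (file XC (b)): write
`Q_d = s^q U` (`U(0) ≠ 0`), rescale `y = z s^{-q}` and divide by `U`: the rows
`Q_j s^{q(d-1-j)}/U` are analytic and the top row is `1`; the Bézout element transports (the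
derivative through `Polynomial.derivative_comp`); a root `w(σ)` of the monic family is `≢ 0`
because `Q_0 ≢ 0`, so `w = σ^m ψ`, and `y = ψ σ^{m - eq}`.  [folklore (the field of convergent
Puiseux series is algebraically closed), made concrete]; nothing here is specific to Schanuel's
conjecture (neither used nor implied); Mantova–Masser's question (PLMS 2024 §1 p. 5) and EC(3,2)
stay OPEN; EAC ⇏ SC.
-/

noncomputable section

open Filter Topology Polynomial

set_option linter.dupNamespace false

namespace Summit.Schanuel.Schanuel.Theorems

/-! ## Part A. Rescaling a row polynomial: `y = z·(s^q)⁻¹` -/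

/-- `Σ_{i ≤ n} a_i s^{qn - qi} z^i = s^{qn} Σ_{i ≤ n} a_i (z (s^q)⁻¹)^i` (`s ≠ 0`). [folklore] -/
theorem sum_row_rescale (a : ℕ → ℂ) (n q : ℕ) {s : ℂ} (hs : s ≠ 0) (z : ℂ) :
    ∑ i ∈ Finset.range (n + 1), a i * s ^ (q * n - q * i) * z ^ i =
      s ^ (q * n) * ∑ i ∈ Finset.range (n + 1), a i * (z * (s ^ q)⁻¹) ^ i := by
  rw [Finset.mul_sum]
  refine Finset.sum_congr rfl fun i hi => ?_
  have hi' : i ≤ n := Nat.lt_succ_iff.1 (Finset.mem_range.1 hi)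
  rw [pow_sub₀ s hs (Nat.mul_le_mul_left q hi'), mul_pow, inv_pow, ← pow_mul]
  ring

/-- The row polynomial as a function of `y`, rescaled: if `Σ_j a_j y^j` and `Σ_j ã_j z^j` satisfy
`Σ_j ã_j z^j = κ · Σ_j a_j (z c)^j` for all `z`, then the derivatives satisfy
`Σ_j j ã_j z^{j-1} = κ c · Σ_j j a_j (zc)^{j-1}`. [folklore] -/
theorem derivative_row_rescale (d : ℕ) (a a₂ : ℕ → ℂ) (κ c : ℂ)
    (h : ∀ z : ℂ, ∑ j ∈ Finset.range (d + 1), a₂ j * z ^ j =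
      κ * ∑ j ∈ Finset.range (d + 1), a j * (z * c) ^ j) (z : ℂ) :
    ∑ j ∈ Finset.range (d + 1), (j : ℂ) * a₂ j * z ^ (j - 1) =
      κ * c * ∑ j ∈ Finset.range (d + 1), (j : ℂ) * a j * (z * c) ^ (j - 1) := by
  classical
  set P : ℂ[X] := ∑ j ∈ Finset.range (d + 1), Polynomial.C (a j) * Polynomial.X ^ j with hP
  set Pt : ℂ[X] := ∑ j ∈ Finset.range (d + 1), Polynomial.C (a₂ j) * Polynomial.X ^ j with hPt
  have hid : Pt = Polynomial.C κ * P.comp (Polynomial.C c * Polynomial.X) := by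
    refine Polynomial.funext fun w => ?_
    rw [Polynomial.eval_mul, Polynomial.eval_C, Polynomial.eval_comp, Polynomial.eval_mul,
      Polynomial.eval_C, Polynomial.eval_X, hPt, hP, eval_rowPoly, eval_rowPoly, mul_comm c w]
    exact h w
  have hder : derivative Pt =
      Polynomial.C κ * (Polynomial.C c * (derivative P).comp (Polynomial.C c * Polynomial.X)) := by
    rw [hid, Polynomial.derivative_C_mul, Polynomial.derivative_comp, Polynomial.derivative_C_mul_X]
  have h1 := congrArg (fun p : ℂ[X] => p.eval z) hder
  simp only [Polynomial.eval_mul, Polynomial.eval_C, Polynomial.eval_comp, Polynomial.eval_X] at h1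
  rw [hPt, hP, eval_derivative_rowPoly, eval_derivative_rowPoly, mul_comm c z] at h1
  rw [h1]
  ring

/-! ## Part B. The root form -/

/-- **The analytic Newton–Puiseux theorem, root form.**  See the module docstring.
[folklore (Newton–Puiseux over convergent power series), made concrete] (new in this form) -/
theorem exists_puiseuxRoot_analyticRows (d : ℕ) (hd : 1 ≤ d) (Q : ℕ → ℂ → ℂ)
    (hQan : ∀ j, AnalyticAt ℂ (Q j) 0) (hQd : ¬ ∀ᶠ s in 𝓝 (0 : ℂ), Q d s = 0)
    (hQ0 : ¬ ∀ᶠ s in 𝓝 (0 : ℂ), Q 0 s = 0)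
    (dA : ℕ) (A B : ℕ → ℂ → ℂ) (hAan : ∀ j, AnalyticAt ℂ (A j) 0)
    (hBan : ∀ j, AnalyticAt ℂ (B j) 0) (r : ℂ → ℂ) (hr : AnalyticAt ℂ r 0)
    (hr0 : ¬ ∀ᶠ s in 𝓝 (0 : ℂ), r s = 0)
    (hbez : ∀ᶠ s in 𝓝[≠] (0 : ℂ), ∀ y : ℂ,
      (∑ i ∈ Finset.range (dA + 1), A i s * y ^ i) *
          (∑ j ∈ Finset.range (d + 1), Q j s * y ^ j) +
        (∑ i ∈ Finset.range (dA + 1), B i s * y ^ i) *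
          (∑ j ∈ Finset.range (d + 1), (j : ℂ) * Q j s * y ^ (j - 1)) = r s) :
    ∃ (e : ℕ) (L : ℤ) (ψ : ℂ → ℂ), 1 ≤ e ∧ AnalyticAt ℂ ψ 0 ∧ ψ 0 ≠ 0 ∧
      ∀ᶠ σ in 𝓝[≠] (0 : ℂ),
        ∑ j ∈ Finset.range (d + 1), Q j (σ ^ e) * (ψ σ * σ ^ L) ^ j = 0 := by
  classical
  /- the top row `Q_d = s^q U`, `U(0) ≠ 0` -/
  obtain ⟨q, U, hUan, hU0, hQdU⟩ := exists_eq_pow_mul_of_not_eventually_zero (hQan d) hQd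
  have hUne : ∀ᶠ s in 𝓝 (0 : ℂ), U s ≠ 0 := hUan.continuousAt.eventually_ne hU0
  /- the monic rows -/
  set Qt : ℕ → ℂ → ℂ := fun j s =>
    if j < d then Q j s * s ^ (q * (d - 1) - q * j) / U s else if j = d then 1 else 0 with hQt
  have hQt_lt : ∀ j, j < d → ∀ s, Qt j s = Q j s * s ^ (q * (d - 1) - q * j) / U s := by
    intro j hj s; simp only [hQt, hj, if_true]
  have hQt_d : ∀ s, Qt d s = 1 := by
    intro s; simp only [hQt, lt_irrefl, if_false, if_true]
  have hQtan : ∀ j, AnalyticAt ℂ (Qt j) 0 := by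
    intro j
    by_cases hj : j < d
    · have h1 : Qt j = fun s => Q j s * s ^ (q * (d - 1) - q * j) / U s :=
        funext fun s => hQt_lt j hj s
      rw [h1]
      exact ((hQan j).mul (analyticAt_id.pow _)).div hUan hU0
    · by_cases hj' : j = d
      · subst hj'
        have h1 : Qt j = fun _ => 1 := funext fun s => hQt_d s
        rw [h1]; exact analyticAt_const
      · have h1 : Qt j = fun _ => 0 := by
          funext s; simp only [hQt, hj, hj', if_false]
        rw [h1]; exact analyticAt_const
  /- the rescaling identity `R̃(s, z) = κ(s) R(s, z (s^q)⁻¹)`, `κ = s^{q(d-1)}/U` -/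
  obtain ⟨d', rfl⟩ : ∃ d', d = d' + 1 := ⟨d - 1, by omega⟩
  have hd' : d' + 1 - 1 = d' := by omega
  have hresc : ∀ s : ℂ, s ≠ 0 → U s ≠ 0 → Q (d' + 1) s = s ^ q * U s → ∀ z : ℂ,
      ∑ j ∈ Finset.range (d' + 1 + 1), Qt j s * z ^ j =
        s ^ (q * d') / U s * ∑ j ∈ Finset.range (d' + 1 + 1), Q j s * (z * (s ^ q)⁻¹) ^ j := by
    intro s hs hUs hQs z
    rw [Finset.sum_range_succ, Finset.sum_range_succ (fun j => Q j s * _ ^ j), hQt_d, hQs, mul_add]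
    have h1 : ∑ j ∈ Finset.range (d' + 1), Qt j s * z ^ j =
        (U s)⁻¹ * ∑ j ∈ Finset.range (d' + 1), Q j s * s ^ (q * d' - q * j) * z ^ j := by
      rw [Finset.mul_sum]
      refine Finset.sum_congr rfl fun j hj => ?_
      rw [hQt_lt j (Finset.mem_range.1 hj), hd']
      field_simp
    rw [h1, sum_row_rescale (fun j => Q j s) d' q hs z]
    have h2 : s ^ (q * d') / U s * (s ^ q * U s * (z * (s ^ q)⁻¹) ^ (d' + 1)) = z ^ (d' + 1) := by
      have hpow : s ^ (q * (d' + 1)) = s ^ (q * d') * s ^ q := by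
        rw [← pow_add, Nat.mul_succ]
      rw [mul_pow, inv_pow, ← pow_mul, hpow]
      field_simp
    rw [h2]
    ring
  /- the transported Bézout element -/
  set At : ℕ → ℂ → ℂ := fun i s => A i s * s ^ (q * dA - q * i) with hAt
  set Bt : ℕ → ℂ → ℂ := fun i s => B i s * s ^ (q * dA - q * i) * s ^ q with hBt
  set rt : ℂ → ℂ := fun s => s ^ (q * d') * s ^ (q * dA) * r s / U s with hrt
  have hAtan : ∀ i, AnalyticAt ℂ (At i) 0 := fun i => (hAan i).mul (analyticAt_id.pow _)
  have hBtan : ∀ i, AnalyticAt ℂ (Bt i) 0 := fun i =>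
    ((hBan i).mul (analyticAt_id.pow _)).mul (analyticAt_id.pow _)
  have hrtan : AnalyticAt ℂ rt 0 :=
    (((analyticAt_id.pow _).mul (analyticAt_id.pow _)).mul hr).div hUan hU0
  have hrt0 : ¬ ∀ᶠ s in 𝓝 (0 : ℂ), rt s = 0 := by
    intro h
    apply hr0
    rcases hr.eventually_eq_zero_or_eventually_ne_zero with h0 | hne
    · exact h0
    · exfalso
      have h2 : ∀ᶠ s in 𝓝[≠] (0 : ℂ), False := by
        filter_upwards [hne, nhdsWithin_le_nhds h, nhdsWithin_le_nhds hUne, self_mem_nhdsWithin]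
          with s h1 h2 h3 h4
        replace h4 : s ≠ 0 := h4
        simp only [hrt] at h2
        rw [div_eq_zero_iff] at h2
        rcases h2 with h2 | h2
        · exact (mul_ne_zero (mul_ne_zero (pow_ne_zero _ h4) (pow_ne_zero _ h4)) h1) h2
        · exact h3 h2
      exact h2.exists.elim fun _ h => h
  have hbezt : ∀ᶠ s in 𝓝[≠] (0 : ℂ), ∀ z : ℂ,
      (∑ i ∈ Finset.range (dA + 1), At i s * z ^ i) *
          (∑ j ∈ Finset.range (d' + 1 + 1), Qt j s * z ^ j) +
        (∑ i ∈ Finset.range (dA + 1), Bt i s * z ^ i) *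
          (∑ j ∈ Finset.range (d' + 1 + 1), (j : ℂ) * Qt j s * z ^ (j - 1)) = rt s := by
    filter_upwards [hbez, nhdsWithin_le_nhds hUne, nhdsWithin_le_nhds hQdU, self_mem_nhdsWithin]
      with s hs hUs hQs hs0 z
    replace hs0 : s ≠ 0 := hs0
    have hR := hresc s hs0 hUs hQs
    have hR' := derivative_row_rescale (d' + 1) (fun j => Q j s) (fun j => Qt j s)
      (s ^ (q * d') / U s) ((s ^ q)⁻¹) hR z
    have hA : ∑ i ∈ Finset.range (dA + 1), At i s * z ^ i =
        s ^ (q * dA) * ∑ i ∈ Finset.range (dA + 1), A i s * (z * (s ^ q)⁻¹) ^ i :=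
      sum_row_rescale (fun i => A i s) dA q hs0 z
    have hB : ∑ i ∈ Finset.range (dA + 1), Bt i s * z ^ i =
        s ^ q * (s ^ (q * dA) * ∑ i ∈ Finset.range (dA + 1), B i s * (z * (s ^ q)⁻¹) ^ i) := by
      rw [← sum_row_rescale (fun i => B i s) dA q hs0 z, Finset.mul_sum]
      refine Finset.sum_congr rfl fun i _ => ?_
      simp only [hBt]; ring
    rw [hR, hR', hA, hB]
    have hb := hs (z * (s ^ q)⁻¹)
    simp only [hrt]
    rw [← hb]
    field_simp
  /- the monic core -/
  obtain ⟨e, w, he, hwan, hwroot⟩ := exists_puiseuxRoot_monic_analyticRows (d' + 1) hd Qt hQtan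
    hQt_d dA At Bt hAtan hBtan rt hrtan hrt0 hbezt
  have he0 : e ≠ 0 := by omega
  /- `w ≢ 0` because `Q_0 ≢ 0` -/
  obtain ⟨n₀, V, hVan, hV0, hQ0V⟩ := exists_eq_pow_mul_of_not_eventually_zero (hQan 0) hQ0
  have hVne : ∀ᶠ s in 𝓝 (0 : ℂ), V s ≠ 0 := hVan.continuousAt.eventually_ne hV0
  have hpowT : Tendsto (fun σ : ℂ => σ ^ e) (𝓝[≠] (0 : ℂ)) (𝓝[≠] (0 : ℂ)) :=
    tendsto_nhdsWithin_iff.2 ⟨(tendsto_pow_nhds_zero e he).mono_left nhdsWithin_le_nhds,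
      eventually_nhdsWithin_of_forall fun σ hσ => pow_ne_zero _ hσ⟩
  have hgood : ∀ᶠ s in 𝓝[≠] (0 : ℂ), s ≠ 0 ∧ U s ≠ 0 ∧ Q (d' + 1) s = s ^ q * U s ∧
      V s ≠ 0 ∧ Q 0 s = s ^ n₀ * V s := by
    filter_upwards [self_mem_nhdsWithin, nhdsWithin_le_nhds hUne, nhdsWithin_le_nhds hQdU,
      nhdsWithin_le_nhds hVne, nhdsWithin_le_nhds hQ0V] with s h1 h2 h3 h4 h5
    exact ⟨h1, h2, h3, h4, h5⟩
  have hw0 : ¬ ∀ᶠ σ in 𝓝 (0 : ℂ), w σ = 0 := by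
    intro hw
    have h2 : ∀ᶠ σ in 𝓝[≠] (0 : ℂ), False := by
      filter_upwards [hpowT.eventually hgood, nhdsWithin_le_nhds hw, nhdsWithin_le_nhds hwroot]
        with σ hg hwσ hroot
      obtain ⟨hs0, hUs, -, hVs, hQ0s⟩ := hg
      rw [hwσ, Finset.sum_range_succ'] at hroot
      simp only [zero_pow (Nat.succ_ne_zero _), mul_zero, Finset.sum_const_zero, zero_add,
        pow_zero, mul_one] at hroot
      rw [hQt_lt 0 (Nat.succ_pos _), hQ0s, div_eq_zero_iff] at hroot
      rcases hroot with h | h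
      · exact (mul_ne_zero (mul_ne_zero (pow_ne_zero _ hs0) hVs) (pow_ne_zero _ hs0)) h
      · exact hUs h
    exact h2.exists.elim fun _ h => h
  obtain ⟨m, ψ, hψan, hψ0, hwψ⟩ := exists_eq_pow_mul_of_not_eventually_zero hwan hw0
  /- conclusion -/
  refine ⟨e, (m : ℤ) - ((e * q : ℕ) : ℤ), ψ, he, hψan, hψ0, ?_⟩
  filter_upwards [hpowT.eventually hgood, nhdsWithin_le_nhds hwψ, nhdsWithin_le_nhds hwroot,
    self_mem_nhdsWithin] with σ hg hwσ hroot hσ0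
  obtain ⟨hs0, hUs, hQs, -, -⟩ := hg
  replace hσ0 : σ ≠ 0 := hσ0
  rw [hresc _ hs0 hUs hQs] at hroot
  have hκ : (σ ^ e) ^ (q * d') / U (σ ^ e) ≠ 0 := div_ne_zero (pow_ne_zero _ hs0) hUs
  have h1 := (mul_eq_zero.1 hroot).resolve_left hκ
  have h2 : ψ σ * σ ^ ((m : ℤ) - ((e * q : ℕ) : ℤ)) = w σ * ((σ ^ e) ^ q)⁻¹ := by
    rw [zpow_sub₀ hσ0, zpow_natCast, zpow_natCast, hwσ, ← pow_mul, div_eq_mul_inv]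
    ring
  rw [h2]
  exact h1

end Summit.Schanuel.Schanuel.Theorems
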